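import Literature.MathematicalPhysics.QuantumLattice.HeisenbergAFEquilibriumTranslationSymmetryBreaking
import HarnessLib

/-!
# The XXZ antiferromagnet on `ℤ^d` in infinite volume: the interaction, torus locality, and the
# infinitesimal-field states as ground states / energy–entropy-balance states with long-range order

Koma–Tasaki, Commun. Math. Phys. **158** (1993) 191–214, treat the spin-`S` XXZ antiferromagnet
`H = Σ_{⟨x,y⟩} (Sˣ_xSˣ_y + Sʸ_xSʸ_y + Δ Sᶻ_xSᶻ_y)` on `ℤ^d` in its three regimes (§7: Thm. 7.1 Ising-like `Δ > 1`,
Cor. 7.2 isotropic `Δ = 1`, Thm. 7.3 planar `0 ≤ Δ < 1`) and define the symmetry-broken infinite-volume states by an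
infinitesimal staggered field, (1.8).  The files `HeisenbergAFInfiniteVolumeGroundState.lean` /
`HeisenbergAFInfiniteVolumeThermalStates.lean` carried this out for `Δ = 1`.  Here, for EVERY anisotropy `Δ`:

* `xxzLatticeInteraction d n J Δ : LatticeInteraction d (n+1)` — the nearest-neighbour XXZ interaction on `ℤ^d`
  (Hermitian, range `1`, translation invariant; its local Hamiltonians are the XXZ Hamiltonians of the window graphs,
  `localHamiltonian_xxzLatticeInteraction_eq_windowGraph`; at `Δ = 1` it is `heisenbergLatticeInteraction`);
* `xxzTorus_commutator_spinEmbed` — torus locality `[H^{XXZ}_L, Γ(Ã)] = Γ([H^{XXZ}_{Λ'}, Ã])` (the XXZ twin of the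
  tree's `heisenbergTorus_commutator_spinEmbed`), whence `sourcedAF_commutator_spinEmbed_xxz` for `H − BO^α`;
* `T = 0`: every infinitesimal-field ground state (`XXZKT.IsInfinitesimalFieldGroundState d n J Δ α`) is an
  infinite-volume ground state of `xxzLatticeInteraction d n J Δ` (`….isGroundState_xxz`);
  `T > 0`: every infinitesimal-field thermal state at `β` is a dKMS (energy–entropy-balance) state of
  `xxzLatticeInteraction d n J Δ` at `β` (`….isDKMSState_xxz`, with the tangent EEB rows, `(C-1)`, `(C-2)`, and the
  stationarity rows proved on the way);
* LONG-RANGE ORDER (Dyson–Lieb–Simon / Kennedy–Lieb–Shastry / Koma–Tasaki, from the tree's infinite-volume floors in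
  `XXZAntiferromagnetInfiniteVolumeOrder.lean`): for `Δ ≥ 1` (`J > 0`, `S ≥ ½`) there are ground states (`d ≥ 2`,
  `(d,S) ≠ (2,½)`) and, for `β ≥ β₀`, dKMS states (`d ≥ 3`) with NÉEL order `(-1)^x Re ω(Sᶻ_x) ≥ σ > 0` at every site;
  for `0 ≤ Δ ≤ 1` the same with planar order `(-1)^x Re ω(Sˣ_x) ≥ √2σ`; in each case there are at least two
  distinct ground / dKMS states (the state sourced along `Sʸ` has `ω(Sˣ_x) = ω(Sᶻ_x) = 0`).

WHAT THIS IS NOT: dKMS ⟺ KMS (Araki–Moriya Thm. 6.4 / Bratteli–Robinson II Thm. 5.3.15) is cited, not formalised;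
nothing about the Hubbard model.

## References
* [KomaTasaki1993] T. Koma, H. Tasaki, CMP **158** (1993), §1 (1.8)–(1.10), Cor. 1.1; §2 (2.3)–(2.5); §7 Thms. 7.1, 7.3.
* [Tasaki2020] H. Tasaki, *Physics and Mathematics of Quantum Many-Body Systems*, §2.4 eq. (2.4.1), §4.4.
* [BratteliRobinsonII1997] O. Bratteli, D. W. Robinson, *OAQSM 2*, §6.2.1–6.2.2, Thm. 6.2.4, Thm. 5.3.15, §6.2.7.
* [ArakiMoriya2003] H. Araki, H. Moriya, Rev. Math. Phys. 15 (2003) 93, Def. 6.3.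
* [FawziFawziScalet2024] H. Fawzi, O. Fawzi, S. O. Scalet, arXiv:2311.18706, Thm. 3.1 (4)–(5).
* [DLS1978] F. J. Dyson, E. H. Lieb, B. Simon, J. Stat. Phys. **18** (1978) 335–383.
* [KennedyLiebShastryJSP1988] T. Kennedy, E. H. Lieb, B. S. Shastry, J. Stat. Phys. **53** (1988) 1019.
-/

noncomputable section

namespace Literature.MathematicalPhysics.QuantumLattice

open Matrix Finset _root_.Filter Literature.Probability.LatticeModels
  Literature.MathematicalPhysics.QuantumLattice.SpinOperators
open scoped _root_.Topology ComplexOrder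

variable {d : ℕ}

/-! ### The XXZ bond operator under relabelling, isotony and embedding -/

section Bond

variable (n : ℕ)

/-- Translations / relabellings move XXZ bonds. [cite: Tasaki2020, §2.4 eq. (2.4.1)] -/
theorem transportOp_xxzBond {X Y : Type*} [Fintype X] [DecidableEq X] [Fintype Y] [DecidableEq Y]
    (e : X ≃ Y) (Δ : ℝ) (x y : X) :
    transportOp e (XXZKT.bond n Δ x y) = XXZKT.bond n Δ (e x) (e y) := by
  simp only [XXZKT.bond, transportOp_eq_reindexAlgEquiv, map_add, map_smul]
  simp only [← transportOp_eq_reindexAlgEquiv, transportOp_spinBond]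

/-- Isotony on XXZ bonds. [cite: BratteliRobinsonII1997, §6.2.1] -/
theorem embedOp_xxzBond {X Y : Finset (Site d)} (h : X ⊆ Y) (Δ : ℝ) (x y : ↥X) :
    embedOp h (XXZKT.bond n Δ x y) = XXZKT.bond n Δ (⟨x, h x.2⟩ : ↥Y) ⟨y, h y.2⟩ := by
  simp only [XXZKT.bond, embedOp_add, embedOp_smul, embedOp_spinBond]

/-- Site embeddings move XXZ bonds. [cite: BratteliRobinsonII1997, §6.2.1] -/
theorem spinEmbed_xxzBond {X Y : Type*} [Fintype X] [DecidableEq X] [Fintype Y] [DecidableEq Y]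
    (φ : X ↪ Y) (Δ : ℝ) (x y : X) :
    spinEmbed φ (XXZKT.bond n Δ x y) = XXZKT.bond n Δ (φ x) (φ y) := by
  simp only [XXZKT.bond, spinBond, map_add, map_smul, map_mul, spinEmbed_siteSpin]

/-- The XXZ bond `{x, y}` is supported on `{x, y}`. [cite: NachtergaeleSims2006, §2] -/
theorem isSupportedOn_xxzBond {V : Type*} [Fintype V] [DecidableEq V] (Δ : ℝ) (x y : V) :
    IsSupportedOn (XXZKT.bond n Δ x y) ({x, y} : Finset V) := by
  have hx : ∀ α, IsSupportedOn (siteSpin n x α : Op V (n + 1)) ({x, y} : Finset V) := fun α =>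
    IsSupportedOn.mono_holds (isSupportedOn_onSite_holds x _) (by simp)
  have hy : ∀ α, IsSupportedOn (siteSpin n y α : Op V (n + 1)) ({x, y} : Finset V) := fun α =>
    IsSupportedOn.mono_holds (isSupportedOn_onSite_holds y _) (by simp)
  have hb : ∀ α, IsSupportedOn (spinBond n α x y : Op V (n + 1)) ({x, y} : Finset V) := fun α => by
    unfold spinBond
    exact IsSupportedOn.smul
      (IsSupportedOn.add (IsSupportedOn.mul_holds (hx α) (hy α)) (IsSupportedOn.mul_holds (hy α) (hx α))) _
  unfold XXZKT.bond
  exact IsSupportedOn.add (IsSupportedOn.add (hb 0) (hb 1)) (IsSupportedOn.smul (hb 2) _)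

/-- The XXZ bond as a function of the unordered bond. [cite: Tasaki2020, §2.4 eq. (2.4.1)] -/
def xxzBondSym {V : Type*} [Fintype V] [DecidableEq V] (Δ : ℝ) : Sym2 V → Op V (n + 1) :=
  Sym2.lift ⟨fun x y => XXZKT.bond n Δ x y, fun x y => (XXZKT.bond_comm n Δ y x)⟩

/-- Unfolding `xxzBondSym` on a pair. [cite: Tasaki2020, §2.4 eq. (2.4.1)] -/
@[simp] theorem xxzBondSym_mk {V : Type*} [Fintype V] [DecidableEq V] (Δ : ℝ) (x y : V) :
    xxzBondSym n Δ s(x, y) = XXZKT.bond n Δ x y := rfl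

/-- `H_XXZ = J Σ_e bond(e)`. [cite: Tasaki2020, §2.4 eq. (2.4.1)] -/
theorem xxzHamiltonian_eq_sum_xxzBondSym {V : Type*} [Fintype V] [DecidableEq V] (G : SimpleGraph V)
    [DecidableRel G.Adj] (J Δ : ℝ) :
    xxzHamiltonian n G J Δ = (J : ℂ) • ∑ e ∈ G.edgeFinset, xxzBondSym n Δ e :=
  XXZKT.xxzHamiltonian_eq_sum_bond n G J Δ

/-- Site embeddings move XXZ bond operators of unordered bonds. [cite: BratteliRobinsonII1997, §6.2.1] -/
theorem spinEmbed_xxzBondSym {X Y : Type*} [Fintype X] [DecidableEq X] [Fintype Y] [DecidableEq Y]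
    (φ : X ↪ Y) (Δ : ℝ) (s : Sym2 X) :
    spinEmbed φ (xxzBondSym n Δ s : Op X (n + 1)) = xxzBondSym n Δ (Sym2.map φ s) := by
  induction s using Sym2.ind with
  | _ x y => rw [Sym2.map_mk, xxzBondSym_mk, xxzBondSym_mk, spinEmbed_xxzBond]

end Bond

/-! ### The nearest-neighbour XXZ interaction on `ℤ^d` -/

/-- **The spin-`n/2` XXZ interaction on `ℤ^d`** (coupling `J`, anisotropy `Δ`): `Φ X = J (Bˣ_{xy} + Bʸ_{xy} + Δ Bᶻ_{xy})`
if `X = {x, y}` is a nearest-neighbour bond `y = x + eᵢ`, and `0` otherwise (as a double sum over `X` with the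
indicator of `y = x + eᵢ`, which selects the bond once, exactly as `heisenbergLatticeInteraction`).
[cite: Tasaki2020, §2.4 eq. (2.4.1)] [cite: KomaTasaki1993, §1] -/
def xxzLatticeInteraction (d n : ℕ) (J Δ : ℝ) : LatticeInteraction d (n + 1) :=
  LatticeInteraction.mk fun X =>
    if X.card = 2 then
      (J : ℂ) • ∑ x : ↥X, ∑ y : ↥X, if (∃ i : Fin d, (y : Site d) = x + unitVec i) then XXZKT.bond n Δ x y else 0
    else 0

/-- Unfolding `xxzLatticeInteraction`. [cite: Tasaki2020, §2.4 eq. (2.4.1)] -/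
theorem xxzLatticeInteraction_apply (n : ℕ) (J Δ : ℝ) (X : Finset (Site d)) :
    xxzLatticeInteraction d n J Δ X =
      if X.card = 2 then
        (J : ℂ) • ∑ x : ↥X, ∑ y : ↥X, if (∃ i : Fin d, (y : Site d) = x + unitVec i) then XXZKT.bond n Δ x y else 0
      else 0 :=
  rfl

/-- At `Δ = 1` the XXZ bond is `𝐒_x·𝐒_y`. [cite: Tasaki2020, §2.4 eq. (2.4.1)] -/
theorem xxzBond_one {V : Type*} [Fintype V] [DecidableEq V] (n : ℕ) (x y : V) :
    XXZKT.bond n 1 x y = spinDot n x y := by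
  simp only [XXZKT.bond, spinDot, Fin.sum_univ_three, Complex.ofReal_one, one_smul]

/-- **At `Δ = 1` the XXZ interaction is the Heisenberg interaction.** [cite: Tasaki2020, §2.4 eq. (2.4.1)] -/
theorem xxzLatticeInteraction_one (n : ℕ) (J : ℝ) :
    xxzLatticeInteraction d n J 1 = heisenbergLatticeInteraction d n J := by
  funext X
  rw [xxzLatticeInteraction_apply, heisenbergLatticeInteraction_apply]
  simp only [xxzBond_one]

/-- The XXZ interaction on `ℤ^d` is Hermitian. [cite: Tasaki2020, §2.4 eq. (2.4.1)] -/
theorem isHermitian_xxzLatticeInteraction (n : ℕ) (J Δ : ℝ) :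
    (xxzLatticeInteraction d n J Δ).IsHermitian := by
  intro X
  rw [xxzLatticeInteraction_apply]
  split_ifs with h2
  · refine IsHermitian.smul ?_ ?_
    · rw [IsHermitian, conjTranspose_sum]
      refine Finset.sum_congr rfl fun x _ => ?_
      rw [conjTranspose_sum]
      refine Finset.sum_congr rfl fun y _ => ?_
      split_ifs
      · exact (XXZKT.bond_isHermitian n Δ x y).eq
      · exact conjTranspose_zero
    · rw [isSelfAdjoint_iff, Complex.star_def, Complex.conj_ofReal]
  · exact isHermitian_zero

/-- Nearest neighbours are at sup-distance `1`. [folklore] -/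
private theorem dist_add_unitVec' (x : Site d) (i : Fin d) : dist x (x + unitVec i) = 1 := by
  rw [dist_comm, dist_eq_norm, add_sub_cancel_left, Pi.norm_single, norm_one]

/-- **The XXZ interaction on `ℤ^d` has range `1`.** [cite: Tasaki2020, §2.4 eq. (2.4.1)] -/
theorem hasFiniteRange_xxzLatticeInteraction (n : ℕ) (J Δ : ℝ) :
    (xxzLatticeInteraction d n J Δ).HasFiniteRange 1 := by
  intro X hX
  rw [xxzLatticeInteraction_apply]
  split_ifs with h2
  · rw [Finset.sum_eq_zero fun x _ => Finset.sum_eq_zero fun y _ => ?_, smul_zero]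
    rw [if_neg]
    rintro ⟨i, hxy⟩
    have hdist : dist (x : Site d) y = 1 := by rw [hxy, dist_add_unitVec']
    have hne : (x : Site d) ≠ y := fun h => by
      rw [h, dist_self] at hdist
      exact zero_ne_one hdist
    have hXe : X = {(x : Site d), (y : Site d)} := by
      refine (Finset.eq_of_subset_of_card_le (fun z hz => ?_) ?_).symm
      · rcases Finset.mem_insert.1 hz with rfl | hz
        · exact x.2
        · rw [Finset.mem_singleton.1 hz]; exact y.2
      · rw [Finset.card_pair hne, h2]
    rw [hXe, Finset.coe_pair, Metric.diam_pair, hdist] at hX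
    exact lt_irrefl _ hX
  · rfl

/-- **The XXZ interaction on `ℤ^d` is translation invariant.** [cite: BratteliRobinsonII1997, §6.2.1 eq. (6.2.3)] -/
theorem isTranslationInvariant_xxzLatticeInteraction (n : ℕ) (J Δ : ℝ) :
    (xxzLatticeInteraction d n J Δ).IsTranslationInvariant := by
  intro v X
  rw [xxzLatticeInteraction_apply, xxzLatticeInteraction_apply, card_map]
  split_ifs with h2
  · simp only [transportOp_eq_reindexAlgEquiv, map_smul, map_sum]
    congr 1
    rw [← (finsetMapEquiv (Site.shift v).toEmbedding X).sum_comp]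
    refine sum_congr rfl fun x _ ↦ ?_
    rw [← (finsetMapEquiv (Site.shift v).toEmbedding X).sum_comp]
    refine sum_congr rfl fun y _ ↦ ?_
    simp only [coe_finsetMapEquiv_apply, Equiv.coe_toEmbedding, Site.shift_apply,
      add_right_comm _ v, add_left_inj]
    split_ifs
    · rw [← transportOp_eq_reindexAlgEquiv, transportOp_xxzBond]
    · rw [map_zero]
  · rw [transportOp_eq_reindexAlgEquiv, map_zero]

/-- Double counting over two-element subsets (`g` vanishing on the diagonal):
`Σ_{Y ⊆ s, #Y = 2} Σ_{x,y ∈ Y} g x y = Σ_{x,y ∈ s} g x y`. [folklore] -/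
private theorem sum_powerset_card_two_sum_sum'' {α M : Type*} [DecidableEq α] [AddCommMonoid M]
    (s : Finset α) (g : α → α → M) (hg : ∀ x, g x x = 0) :
    ∑ Y ∈ s.powerset with Y.card = 2, ∑ x ∈ Y, ∑ y ∈ Y, g x y = ∑ x ∈ s, ∑ y ∈ s, g x y := by
  have key : ∀ Y ∈ s.powerset.filter (·.card = 2),
      ∑ x ∈ Y, ∑ y ∈ Y, g x y = ∑ x ∈ s, ∑ y ∈ s, if x ∈ Y ∧ y ∈ Y then g x y else 0 := by
    intro Y hY
    have hYs : Y ⊆ s := mem_powerset.1 (mem_filter.1 hY).1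
    rw [← Finset.sum_subset hYs (f := fun x => ∑ y ∈ s, if x ∈ Y ∧ y ∈ Y then g x y else 0)]
    · refine sum_congr rfl fun x hx => ?_
      rw [← Finset.sum_subset hYs]
      · exact sum_congr rfl fun y hy => by rw [if_pos ⟨hx, hy⟩]
      · intro y _ hy
        rw [if_neg fun h => hy h.2]
    · intro x _ hx
      exact sum_eq_zero fun y _ => by rw [if_neg fun h => hx h.1]
  rw [sum_congr rfl key, sum_comm]
  refine sum_congr rfl fun x hx => ?_
  rw [sum_comm]
  refine sum_congr rfl fun y hy => ?_
  rw [← sum_filter, sum_const]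
  by_cases hxy : x = y
  · subst hxy
    rw [hg, smul_zero]
  · have hfilter : ((s.powerset.filter (·.card = 2)).filter fun Y => x ∈ Y ∧ y ∈ Y) = {{x, y}} := by
      ext Y
      simp only [mem_filter, mem_powerset, mem_singleton]
      constructor
      · rintro ⟨⟨-, hcard⟩, hxY, hyY⟩
        obtain ⟨a, b, -, rfl⟩ := card_eq_two.1 hcard
        simp only [mem_insert, mem_singleton] at hxY hyY
        rcases hxY with rfl | rfl <;> rcases hyY with rfl | rfl
        · exact absurd rfl hxy
        · rfl
        · exact Finset.pair_comm _ _
        · exact absurd rfl hxy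
      · rintro rfl
        refine ⟨⟨fun z hz => ?_, card_pair hxy⟩, mem_insert_self _ _,
          mem_insert_of_mem (mem_singleton_self _)⟩
        simp only [mem_insert, mem_singleton] at hz
        rcases hz with rfl | rfl
        · exact hx
        · exact hy
    rw [hfilter, card_singleton, one_smul]

/-- **The local Hamiltonians of the XXZ interaction are bond sums**:
`Σ_{Y ⊆ Λ'} Φ Y = J Σ_{x, y ∈ Λ', y = x + eᵢ} bond(x, y)`. [cite: Tasaki2020, §2.4 eq. (2.4.1)] -/
theorem localHamiltonian_xxzLatticeInteraction (n : ℕ) (J Δ : ℝ) (Λ' : Finset (Site d)) :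
    localHamiltonian ((xxzLatticeInteraction d n J Δ).restrict Λ') univ =
      (J : ℂ) • ∑ x : ↥Λ', ∑ y : ↥Λ',
        if (∃ i : Fin d, (y : Site d) = x + unitVec i) then XXZKT.bond n Δ x y else 0 := by
  classical
  set g : Site d → Site d → Op ↥Λ' (n + 1) := fun x y =>
    if hx : x ∈ Λ' then if hy : y ∈ Λ' then
      if (∃ i : Fin d, y = x + unitVec i) then XXZKT.bond n Δ (⟨x, hx⟩ : ↥Λ') ⟨y, hy⟩ else 0 else 0 else 0 with hg
  have hgxx : ∀ x, g x x = 0 := fun x => by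
    simp only [hg]
    by_cases hx : x ∈ Λ'
    · rw [dif_pos hx, dif_pos hx, if_neg]
      rintro ⟨i, hi⟩
      exact self_ne_add_unitVec x i hi
    · rw [dif_neg hx]
  have hterm : ∀ Y ∈ Λ'.powerset,
      (if hY : Y ⊆ Λ' then embedOp hY (xxzLatticeInteraction d n J Δ Y) else 0) =
        if Y.card = 2 then (J : ℂ) • ∑ x ∈ Y, ∑ y ∈ Y, g x y else 0 := by
    intro Y hY
    have hYs : Y ⊆ Λ' := mem_powerset.1 hY
    rw [dif_pos hYs, xxzLatticeInteraction_apply]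
    split_ifs with h2
    · rw [embedOp_smul, embedOp_sum]
      congr 1
      rw [← Finset.sum_coe_sort Y]
      refine sum_congr rfl fun x _ => ?_
      rw [embedOp_sum, ← Finset.sum_coe_sort Y]
      refine sum_congr rfl fun y _ => ?_
      simp only [hg, dif_pos (hYs x.2), dif_pos (hYs y.2)]
      split_ifs
      · exact embedOp_xxzBond n hYs Δ x y
      · exact embedOp_zero hYs
    · exact embedOp_zero hYs
  rw [localHamiltonian_restrict_eq_sum, sum_congr rfl hterm, ← sum_filter, ← smul_sum,
    sum_powerset_card_two_sum_sum'' Λ' g hgxx, ← Finset.sum_coe_sort Λ']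
  congr 1
  refine sum_congr rfl fun x _ => ?_
  rw [← Finset.sum_coe_sort Λ']
  refine sum_congr rfl fun y _ => ?_
  simp only [hg, dif_pos x.2, dif_pos y.2]

/-- `eᵢ + eⱼ ≠ 0` in `ℤ^d`. [folklore] -/
private theorem unitVec_add_unitVec_ne_zero' (i j : Fin d) : (unitVec i : Site d) + unitVec j ≠ 0 := by
  intro h
  have h1 := congrFun h i
  by_cases hij : i = j
  · subst hij
    simp [unitVec] at h1
  · simp [unitVec, Pi.single_eq_of_ne hij] at h1

/-- A bond is oriented exactly one way. [folklore] -/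
private theorem not_both_orientations' {x y : Site d} (h₁ : ∃ i : Fin d, y = x + unitVec i)
    (h₂ : ∃ j : Fin d, x = y + unitVec j) : False := by
  obtain ⟨i, hi⟩ := h₁
  obtain ⟨j, hj⟩ := h₂
  refine unitVec_add_unitVec_ne_zero' (d := d) i j ?_
  have h : x + (unitVec i + unitVec j) = x + 0 := by rw [← add_assoc, ← hi, ← hj, add_zero]
  exact add_left_cancel h

/-- **Edge sums over a window graph as oriented pair sums**: for a symmetric bond family `b`,
`Σ_{e ∈ E(windowGraph Λ')} b(e) = Σ_{x, y ∈ Λ', y = x + eᵢ} b x y` (each bond `{x, x + eᵢ}` is counted once, with its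
orientation). [cite: Tasaki2020, §2.4 eq. (2.4.1)] -/
theorem windowGraph_sum_edgeFinset_lift {M : Type*} [AddCommMonoid M] (Λ' : Finset (Site d))
    (b : ↥Λ' → ↥Λ' → M) (hb : ∀ x y, b x y = b y x) :
    ∑ e ∈ (windowGraph Λ').edgeFinset, Sym2.lift ⟨b, hb⟩ e =
      ∑ x : ↥Λ', ∑ y : ↥Λ', if (∃ i : Fin d, (y : Site d) = x + unitVec i) then b x y else 0 := by
  classical
  set P : Finset (↥Λ' × ↥Λ') := univ.filter fun p => ∃ i : Fin d, (p.2 : Site d) = p.1 + unitVec i with hP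
  have hsum : (∑ x : ↥Λ', ∑ y : ↥Λ', if (∃ i : Fin d, (y : Site d) = x + unitVec i) then b x y else 0) =
      ∑ p ∈ P, b p.1 p.2 := by
    rw [hP, sum_filter, ← Finset.sum_product']
    rfl
  rw [hsum]
  symm
  refine Finset.sum_nbij (fun p => s(p.1, p.2)) ?_ ?_ ?_ ?_
  · intro p hp
    rw [hP, mem_filter] at hp
    obtain ⟨i, hi⟩ := hp.2
    rw [SimpleGraph.mem_edgeFinset, SimpleGraph.mem_edgeSet, windowGraph_adj]
    exact ⟨fun h => self_ne_add_unitVec (p.1 : Site d) i (by rw [← hi, h]), Or.inl ⟨i, hi⟩⟩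
  · intro p hp p' hp' h
    rw [hP, Finset.mem_coe, mem_filter] at hp hp'
    rcases Sym2.eq_iff.1 h with ⟨h1, h2⟩ | ⟨h1, h2⟩
    · exact Prod.ext h1 h2
    · exfalso
      refine not_both_orientations' hp.2 ?_
      obtain ⟨j, hj⟩ := hp'.2
      exact ⟨j, by rw [h1, h2]; exact hj⟩
  · intro e he
    rw [Finset.mem_coe, SimpleGraph.mem_edgeFinset] at he
    induction e using Sym2.ind with
    | _ x y =>
      rw [SimpleGraph.mem_edgeSet, windowGraph_adj] at he
      rcases he.2 with h | h
      · exact ⟨(x, y), by rw [hP, Finset.mem_coe, mem_filter]; exact ⟨mem_univ _, h⟩, rfl⟩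
      · refine ⟨(y, x), by rw [hP, Finset.mem_coe, mem_filter]; exact ⟨mem_univ _, h⟩, ?_⟩
        change s(y, x) = s(x, y)
        exact Sym2.eq_swap
  · intro p _
    rfl

/-- **The XXZ Hamiltonian of a window graph as an oriented pair sum.** [cite: Tasaki2020, §2.4 eq. (2.4.1)] -/
theorem xxzHamiltonian_windowGraph_eq_sum (n : ℕ) (J Δ : ℝ) (Λ' : Finset (Site d)) :
    xxzHamiltonian n (windowGraph Λ') J Δ =
      (J : ℂ) • ∑ x : ↥Λ', ∑ y : ↥Λ',
        if (∃ i : Fin d, (y : Site d) = x + unitVec i) then XXZKT.bond n Δ x y else 0 := by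
  rw [XXZKT.xxzHamiltonian_eq_sum_bond, windowGraph_sum_edgeFinset_lift]

/-- **The local Hamiltonians of the XXZ interaction on `ℤ^d` are the XXZ Hamiltonians of the window graphs.**
[cite: BratteliRobinsonII1997, §6.2.1 eq. (6.2.4)] -/
theorem localHamiltonian_xxzLatticeInteraction_eq_windowGraph (n : ℕ) (J Δ : ℝ) (Λ' : Finset (Site d)) :
    localHamiltonian ((xxzLatticeInteraction d n J Δ).restrict Λ') univ = xxzHamiltonian n (windowGraph Λ') J Δ := by
  rw [localHamiltonian_xxzLatticeInteraction, xxzHamiltonian_windowGraph_eq_sum]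

/-! ### Torus locality of the XXZ Hamiltonian -/

section Commutator

variable {L : ℕ} [NeZero L]

omit [NeZero L] in
/-- `x ↦ x mod L` is additive. [folklore] -/
private theorem torusProj_add' (L : ℕ) (x y : Site d) :
    Torus.proj L (x + y) = Torus.proj L x + Torus.proj L y := by
  funext i
  simp [Torus.proj]

omit [NeZero L] in
/-- `eᵢ mod L = eᵢ`. [folklore] -/
private theorem torusProj_unitVec' (L : ℕ) (i : Fin d) :
    Torus.proj L (unitVec i : Site d) = Pi.single i 1 := by
  funext j
  by_cases h : j = i
  · subst h; simp [Torus.proj, unitVec]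
  · simp [Torus.proj, unitVec, Pi.single_eq_of_ne h]

/-- **The commutator pull-back for the XXZ model**: for `B` living on an inner region `Λ` all of whose lattice
neighbours lie in the window `Λ'` (and `x ↦ x mod L` injective on `Λ'`),
`[H^{XXZ}_L, Γ(ι_{Λ'})(Γ(incl) B)] = Γ(ι_{Λ'}) [H^{XXZ}_{Λ'}, Γ(incl) B]` — the torus bonds not coming from window bonds do
not touch the image of `Λ` (the XXZ twin of `heisenbergTorus_commutator_spinEmbed`).
[cite: BratteliRobinsonII1997, §6.2.1 (local commutativity)] -/
theorem xxzTorus_commutator_spinEmbed (n : ℕ) (J Δ : ℝ) {Λ Λ' : Finset (Site d)} (hΛ : Λ ⊆ Λ')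
    (hclosed : ∀ x ∈ Λ, ∀ i : Fin d, x + unitVec i ∈ Λ' ∧ x - unitVec i ∈ Λ')
    (h' : Set.InjOn (Torus.proj (d := d) L) ↑Λ') (B : Op ↥Λ (n + 1)) :
    xxzHamiltonian n (torusGraph d L) J Δ *
          spinEmbed (spinToTorusEmb L h') (spinEmbed (siteIncl hΛ) B) -
        spinEmbed (spinToTorusEmb L h') (spinEmbed (siteIncl hΛ) B) *
          xxzHamiltonian n (torusGraph d L) J Δ =
      spinEmbed (spinToTorusEmb L h')
        (xxzHamiltonian n (windowGraph Λ') J Δ * spinEmbed (siteIncl hΛ) B -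
          spinEmbed (siteIncl hΛ) B * xxzHamiltonian n (windowGraph Λ') J Δ) := by
  classical
  set φ := spinToTorusEmb L h' with hφ
  set ψ : Sym2 ↥Λ' → Sym2 (TorusSite d L) := Sym2.map φ with hψ
  set E := (torusGraph d L).edgeFinset with hE
  set Ew := (windowGraph Λ').edgeFinset with hEw
  set I := Ew.image ψ with hI
  set ΓB := spinEmbed φ (spinEmbed (siteIncl hΛ) B) with hΓB
  -- (1) the window Hamiltonian is pulled back to the sum over the image bonds
  have hψinj : ∀ e ∈ Ew, ∀ e' ∈ Ew, ψ e = ψ e' → e = e' :=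
    fun e _ e' _ h => Sym2.map.injective φ.injective h
  have hHw : spinEmbed φ (xxzHamiltonian n (windowGraph Λ') J Δ) = (J : ℂ) • ∑ e' ∈ I, xxzBondSym n Δ e' := by
    rw [xxzHamiltonian_eq_sum_xxzBondSym, map_smul, map_sum, hI, Finset.sum_image hψinj]
    exact congrArg _ (Finset.sum_congr rfl fun e _ => spinEmbed_xxzBondSym n φ Δ e)
  -- (2) image bonds are torus bonds
  have hIE : I ⊆ E := by
    intro e' he'
    obtain ⟨e, he, rfl⟩ := Finset.mem_image.1 he'
    induction e using Sym2.ind with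
    | _ x y =>
      rw [hEw, SimpleGraph.mem_edgeFinset, SimpleGraph.mem_edgeSet] at he
      rw [hψ, Sym2.map_mk, hE, SimpleGraph.mem_edgeFinset, SimpleGraph.mem_edgeSet]
      exact torusGraph_adj_of_windowGraph_adj h' he
  -- (3) the remaining torus bonds do not touch the image of `Λ`
  have hΓB' : ΓB = spinEmbed (spinToTorusEmb L (h'.mono (by exact_mod_cast hΛ))) B := by
    rw [hΓB, hφ, spinEmbed_toTorus_incl]
  have hfar : ∀ e' ∈ E \ I, Commute ΓB (xxzBondSym n Δ e') := by
    intro e' he'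
    rw [Finset.mem_sdiff] at he'
    obtain ⟨heE, heI⟩ := he'
    induction e' using Sym2.ind with
    | _ x' y' =>
      rw [hE, SimpleGraph.mem_edgeFinset, SimpleGraph.mem_edgeSet] at heE
      rw [xxzBondSym_mk, hΓB']
      refine spinEmbed_commute_of_disjoint _ B (isSupportedOn_xxzBond n Δ x' y') ?_
      rw [Finset.disjoint_iff_ne]
      rintro z hz _ hz' rfl
      rw [rangeSites, Finset.mem_map] at hz
      obtain ⟨⟨x, hx⟩, -, hxz⟩ := hz
      rw [spinToTorusEmb_apply] at hxz
      apply heI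
      rw [hI, Finset.mem_image]
      have key : ∀ {a b : TorusSite d L}, (torusGraph d L).Adj a b → a = Torus.proj L x →
          ∃ e ∈ Ew, ψ e = s(a, b) := by
        intro a b hab ha
        rw [torusGraph_adj_iff] at hab
        rcases hab.2 with ⟨i, hi⟩ | ⟨i, hi⟩
        · refine ⟨s(⟨x, hΛ hx⟩, ⟨x + unitVec i, (hclosed x hx i).1⟩), ?_, ?_⟩
          · rw [hEw, SimpleGraph.mem_edgeFinset, SimpleGraph.mem_edgeSet]
            exact windowGraph_adj_add_unitVec (hΛ hx) i _
          · rw [hψ, Sym2.map_mk, hφ, spinToTorusEmb_apply, spinToTorusEmb_apply]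
            simp only
            rw [torusProj_add', torusProj_unitVec', ← ha, ← hi]
        · refine ⟨s(⟨x, hΛ hx⟩, ⟨x - unitVec i, (hclosed x hx i).2⟩), ?_, ?_⟩
          · rw [hEw, SimpleGraph.mem_edgeFinset, SimpleGraph.mem_edgeSet]
            exact windowGraph_adj_sub_unitVec (hΛ hx) i _
          · rw [hψ, Sym2.map_mk, hφ, spinToTorusEmb_apply, spinToTorusEmb_apply]
            simp only
            have hb : b = Torus.proj L (x - unitVec i) := by
              rw [sub_eq_add_neg, torusProj_add', ← ha, hi]
              have hneg : Torus.proj L (-(unitVec i : Site d)) = -Pi.single i 1 := by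
                rw [← torusProj_unitVec' L i]; funext j; simp [Torus.proj]
              rw [hneg, add_neg_cancel_right]
            rw [← ha, hb]
      rcases Finset.mem_insert.1 hz' with rfl | hz''
      · exact key heE hxz.symm
      · rw [Finset.mem_singleton] at hz''
        subst hz''
        obtain ⟨e, he, hee⟩ := key heE.symm hxz.symm
        exact ⟨e, he, by rw [hee, Sym2.eq_swap]⟩
  -- (4) assemble
  have hsplit : xxzHamiltonian n (torusGraph d L) J Δ =
      (J : ℂ) • ∑ e' ∈ I, xxzBondSym n Δ e' + (J : ℂ) • ∑ e' ∈ E \ I, xxzBondSym n Δ e' := by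
    rw [xxzHamiltonian_eq_sum_xxzBondSym, ← hE, ← smul_add, ← Finset.sum_sdiff hIE]
    exact congrArg _ (add_comm _ _)
  have hcomm : ((J : ℂ) • ∑ e' ∈ E \ I, xxzBondSym n Δ e') * ΓB =
      ΓB * ((J : ℂ) • ∑ e' ∈ E \ I, xxzBondSym n Δ e') := by
    rw [smul_mul_assoc, mul_smul_comm, Finset.sum_mul, Finset.mul_sum]
    exact congrArg _ (Finset.sum_congr rfl fun e' he' => ((hfar e' he').eq).symm)
  rw [hsplit, add_mul, mul_add, hcomm, add_sub_add_right_eq_sub, ← hHw, ← map_mul, ← map_mul, ← map_sub]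

end Commutator


namespace XXZKT

/-! ### The sourced Hamiltonian `H^{XXZ} − BO^α`: locality of its generator; the `y`-sourced states -/

section Torus

variable {L : ℕ} [NeZero L] (n : ℕ)

variable {n} in
/-- **Torus locality of the sourced XXZ generator** (every `Δ`): for `A ∈ 𝔄_Λ`, `Λ_1 = thicken Λ 1` pulled injectively
into the even torus and `X = Γ(A ⊗ 𝟙)`,
`(H^{XXZ}_L − BO^α_L) X − X (H^{XXZ}_L − BO^α_L) = Γ([H^{XXZ}_{Λ_1}, Ã]) − B·Γ(Σ_{y ∈ Λ_1} (-1)^y [S^α_y, Ã])`.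
[cite: BratteliRobinsonII1997, §6.2.1 (local commutativity)] [cite: KomaTasaki1993, §1 (1.8)] -/
theorem sourcedAF_commutator_spinEmbed_xxz (hL : Even L) (J Δ : ℝ) (α : Fin 3) (B : ℝ) {Λ : Finset (Site d)}
    (h' : Set.InjOn (Torus.proj (d := d) L) ↑(thicken Λ 1)) (A : Op ↥Λ (n + 1)) :
    sourcedAF d L n J Δ α B * spinEmbed (spinToTorusEmb L h') (embedOp (subset_thicken Λ 1) A) -
        spinEmbed (spinToTorusEmb L h') (embedOp (subset_thicken Λ 1) A) * sourcedAF d L n J Δ α B =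
      spinEmbed (spinToTorusEmb L h')
          (localHamiltonian ((xxzLatticeInteraction d n J Δ).restrict (thicken Λ 1)) univ *
              embedOp (subset_thicken Λ 1) A -
            embedOp (subset_thicken Λ 1) A *
              localHamiltonian ((xxzLatticeInteraction d n J Δ).restrict (thicken Λ 1)) univ) -
        (B : ℂ) • spinEmbed (spinToTorusEmb L h')
          (∑ y : ↥(thicken Λ 1), (latticeStagger (y : Site d) : ℂ) •
            (siteSpin n y α * embedOp (subset_thicken Λ 1) A - embedOp (subset_thicken Λ 1) A * siteSpin n y α)) := by
  set X := spinEmbed (spinToTorusEmb L h') (embedOp (subset_thicken Λ 1) A) with hX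
  have hH : xxzHamiltonian n (torusGraph d L) J Δ * X - X * xxzHamiltonian n (torusGraph d L) J Δ =
      spinEmbed (spinToTorusEmb L h')
        (localHamiltonian ((xxzLatticeInteraction d n J Δ).restrict (thicken Λ 1)) univ *
            embedOp (subset_thicken Λ 1) A -
          embedOp (subset_thicken Λ 1) A *
            localHamiltonian ((xxzLatticeInteraction d n J Δ).restrict (thicken Λ 1)) univ) := by
    rw [hX, ← spinEmbed_siteIncl_eq_embedOp, localHamiltonian_xxzLatticeInteraction_eq_windowGraph]
    exact xxzTorus_commutator_spinEmbed n J Δ (subset_thicken Λ 1)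
      (fun x hx i => add_sub_unitVec_mem_thicken_one hx i) h' A
  have hO : stagSpin n (torusParityExp d L) α * X - X * stagSpin n (torusParityExp d L) α =
      spinEmbed (spinToTorusEmb L h')
        (∑ y : ↥(thicken Λ 1), (latticeStagger (y : Site d) : ℂ) •
          (siteSpin n y α * embedOp (subset_thicken Λ 1) A - embedOp (subset_thicken Λ 1) A * siteSpin n y α)) := by
    rw [hX, stagSpin_comm_spinEmbed n]
    congr 1
    refine Finset.sum_congr rfl fun y _ => ?_
    rw [spinToTorusEmb_apply, stagSign_torusParityExp_proj hL]
  have hK : sourcedAF d L n J Δ α B =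
      xxzHamiltonian n (torusGraph d L) J Δ - (B : ℂ) • stagSpin n (torusParityExp d L) α := rfl
  rw [hK, Matrix.sub_mul, Matrix.mul_sub, Matrix.smul_mul, Matrix.mul_smul, ← hH, ← hO, smul_sub]
  abel

/-- **No `z`-magnetisation in the `y`-sourced Gibbs state**: `⟨S^z_x⟩_{β, H − BO^y} = 0` (the half turn about `y`
reverses `S^z`). [cite: KomaTasaki1993, §2 (2.3)–(2.5)] -/
theorem gibbsState_sourcedAF_one_siteSpin_two (J Δ β B : ℝ) (z : TorusSite d L) :
    gibbsState β (sourcedAF d L n J Δ 1 B) (siteSpin n z 2) = 0 := by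
  have h := gibbsState_conj_of_symmetry β (halfTurnY_conjTranspose_mul n) (halfTurnY_mul_conjTranspose n)
    (halfTurnY_conj_sourcedAF_one (L := L) n J Δ B) (siteSpin n z 2)
  rw [halfTurnY_conj_siteSpin_two, map_neg] at h
  linear_combination (-(1 : ℂ) / 2) * h

/-- **No `x`-magnetisation in the `y`-sourced tracial ground state** of `H − BO^y`.
[cite: KomaTasaki1993, §2 (2.3)–(2.5), §7] -/
theorem groundStateFunctional_sourcedAF_one_siteSpin_zero (J Δ B : ℝ) (z : TorusSite d L) :
    (sourcedAF d L n J Δ 1 B).groundStateFunctional (siteSpin n z 0) = 0 := by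
  have h := groundStateFunctional_conj_of_symmetry (sourcedAF_isHermitian n J Δ 1 B)
    (halfTurnY_conjTranspose_mul n) (halfTurnY_conj_sourcedAF_one (L := L) n J Δ B) (siteSpin n z 0)
  rw [halfTurnY_conj_siteSpin_zero, map_neg] at h
  linear_combination (-(1 : ℂ) / 2) * h

/-- **No `z`-magnetisation in the `y`-sourced tracial ground state** of `H − BO^y`.
[cite: KomaTasaki1993, §2 (2.3)–(2.5), §7] -/
theorem groundStateFunctional_sourcedAF_one_siteSpin_two (J Δ B : ℝ) (z : TorusSite d L) :
    (sourcedAF d L n J Δ 1 B).groundStateFunctional (siteSpin n z 2) = 0 := by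
  have h := groundStateFunctional_conj_of_symmetry (sourcedAF_isHermitian n J Δ 1 B)
    (halfTurnY_conjTranspose_mul n) (halfTurnY_conj_sourcedAF_one (L := L) n J Δ B) (siteSpin n z 2)
  rw [halfTurnY_conj_siteSpin_two, map_neg] at h
  linear_combination (-(1 : ℂ) / 2) * h

end Torus

/-! ### A vanishing one-point function passes to the infinitesimal-field states -/

section OnePoint

variable {n : ℕ} {ρB : ℝ → ∀ k : ℕ, Op (TorusSite d (2 * k + 2)) (n + 1) →ₗ[ℂ] ℂ} {ω : InfVolState d (n + 1)}

/-- If the sourced finite-volume functionals annihilate every `S^γ_y`, the infinitesimal-field state has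
`ω(S^γ_x) = 0` at every site. [cite: KomaTasaki1993, §1 (1.8)–(1.9)] -/
theorem IsInfinitesimalFieldState.expect_siteSpinAt_eq_zero (h : IsInfinitesimalFieldState ρB ω) {γ : Fin 3}
    (hρ : ∀ (B : ℝ) (k : ℕ) (y : TorusSite d (2 * k + 2)), ρB B k (siteSpin n y γ) = 0) (x : Site d) :
    ω.expect {x} (siteSpinAt n x γ) = 0 := by
  obtain ⟨B, ωB, -, -, hωB, hlim⟩ := h
  have hm : ∀ m, (ωB m).expect {x} (siteSpinAt n x γ) = 0 := by
    intro m
    obtain ⟨κ, -, hω⟩ := hωB m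
    have ht : Tendsto (fun _ : ℕ => (0 : ℂ)) atTop
        (𝓝 ((ωB m).expect {x} (onSite ⟨x, mem_singleton_self x⟩ (spinVec n γ)))) := by
      refine (hω.tendsto_onSite x (spinVec n γ)).congr fun j => ?_
      exact hρ (B m) (κ j) (Torus.proj (2 * κ j + 2) x)
    exact tendsto_nhds_unique ht tendsto_const_nhds
  have hl := hlim {x} (siteSpinAt n x γ)
  rw [show (fun m => (ωB m).expect {x} (siteSpinAt n x γ)) = fun _ => (0 : ℂ) from funext hm] at hl
  exact tendsto_nhds_unique hl tendsto_const_nhds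

variable {J Δ β : ℝ}

/-- The `y`-sourced infinitesimal-field thermal state has `ω̃(S^z_x) = 0`. [cite: KomaTasaki1993, §2 (2.3)–(2.5), §1 (1.8)] -/
theorem IsInfinitesimalFieldThermalState.expect_siteSpinAt_two_eq_zero
    (h : IsInfinitesimalFieldThermalState d n J Δ 1 β ω) (x : Site d) : ω.expect {x} (siteSpinAt n x 2) = 0 :=
  IsInfinitesimalFieldState.expect_siteSpinAt_eq_zero h
    (fun B _ y => gibbsState_sourcedAF_one_siteSpin_two n J Δ β B y) x

/-- The `y`-sourced infinitesimal-field ground state has `ω̃(S^x_x) = 0`. [cite: KomaTasaki1993, §2 (2.3)–(2.5), §7] -/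
theorem IsInfinitesimalFieldGroundState.expect_siteSpinAt_zero_eq_zero
    (h : IsInfinitesimalFieldGroundState d n J Δ 1 ω) (x : Site d) : ω.expect {x} (siteSpinAt n x 0) = 0 :=
  IsInfinitesimalFieldState.expect_siteSpinAt_eq_zero h
    (fun B _ y => groundStateFunctional_sourcedAF_one_siteSpin_zero n J Δ B y) x

/-- The `y`-sourced infinitesimal-field ground state has `ω̃(S^z_x) = 0`. [cite: KomaTasaki1993, §2 (2.3)–(2.5), §7] -/
theorem IsInfinitesimalFieldGroundState.expect_siteSpinAt_two_eq_zero
    (h : IsInfinitesimalFieldGroundState d n J Δ 1 ω) (x : Site d) : ω.expect {x} (siteSpinAt n x 2) = 0 :=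
  IsInfinitesimalFieldState.expect_siteSpinAt_eq_zero h
    (fun B _ y => groundStateFunctional_sourcedAF_one_siteSpin_two n J Δ B y) x

end OnePoint

/-! ### `T = 0`: the infinitesimal-field ground states are ground states of the XXZ interaction -/

section Ground

variable {n : ℕ} {J Δ : ℝ} {α : Fin 3} {ω : InfVolState d (n + 1)}

open scoped Matrix.Norms.L2Operator in
/-- **THE INFINITESIMAL-FIELD GROUND STATES OF THE XXZ ANTIFERROMAGNET ARE INFINITE-VOLUME GROUND STATES** of the
nearest-neighbour XXZ interaction (range `1`), for every `Δ`, `J`, `d`, `n` and source direction `α`: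
`ω(Ã⋆[H_{Λ_1}, Ã]) ≥ 0` for every local `A` (Bratteli–Robinson Def. 5.3.18 / `InfVolState.IsGroundState`).
On each torus `⟨Xᴴ[K_L, X]⟩ ≥ 0` in the tracial ground state of `K_L = H_L − BO_L`, and
`Xᴴ[K_L, X] = Γ(Ãᴴ[H_{Λ_1},Ã]) − B·Γ(D)` (`sourcedAF_commutator_spinEmbed_xxz`); pass to `L → ∞`, then `B ↓ 0`.
[cite: KomaTasaki1993, §1 (1.8), §7] [cite: BratteliRobinsonII1997, Def. 5.3.18, §6.2.7] [cite: Tasaki2020, App. A.7] -/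
theorem IsInfinitesimalFieldGroundState.isGroundState_xxz (h : IsInfinitesimalFieldGroundState d n J Δ α ω) :
    ω.IsGroundState (xxzLatticeInteraction d n J Δ) 1 := by
  classical
  intro Λ A
  set Λ' := thicken Λ (1 : ℝ) with hΛ'
  set At : Op ↥Λ' (n + 1) := embedOp (subset_thicken Λ 1) A with hAt
  set H' : Op ↥Λ' (n + 1) := localHamiltonian ((xxzLatticeInteraction d n J Δ).restrict Λ') univ with hH'
  set C : Op ↥Λ' (n + 1) := Atᴴ * (H' * At - At * H') with hC
  set D : Op ↥Λ' (n + 1) :=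
    Atᴴ * ∑ y : ↥Λ', (latticeStagger (y : Site d) : ℂ) • (siteSpin n y α * At - At * siteSpin n y α) with hD
  have hgoal : -Complex.I * ω.expect Λ' (Atᴴ * derivation (xxzLatticeInteraction d n J Δ) 1 Λ A) =
      ω.expect Λ' C := by
    have hder : derivation (xxzLatticeInteraction d n J Δ) 1 Λ A = Complex.I • (H' * At - At * H') := rfl
    rw [hder, Matrix.mul_smul, map_smul, smul_eq_mul, ← mul_assoc, ← hC]
    simp
  rw [hgoal]
  obtain ⟨B, ωB, -, hB0, hωB, hlim⟩ := h
  -- Step A: at each `B_m`, `0 ≤ ω_m(C) - B_m ω_m(D)`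
  have hstep : ∀ m : ℕ, 0 ≤ (ωB m).expect Λ' C - (B m : ℂ) * (ωB m).expect Λ' D := by
    intro m
    obtain ⟨κ, hκ, hω⟩ := hωB m
    refine ge_of_tendsto ((hω Λ' C).sub ((hω Λ' D).const_mul _)) ?_
    filter_upwards [eventually_injOn_proj_of_tendsto Λ' (tendsto_two_mul_add_two hκ)] with j hj
    have hk : Even (2 * κ j + 2) := ⟨κ j + 1, by ring⟩
    rw [torusSpinExpect_of_injOn hj, torusSpinExpect_of_injOn hj]
    set X := spinEmbed (spinToTorusEmb (2 * κ j + 2) hj) At with hX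
    have hcomm : sourcedAF d (2 * κ j + 2) n J Δ α (B m) * X - X * sourcedAF d (2 * κ j + 2) n J Δ α (B m) =
        spinEmbed (spinToTorusEmb (2 * κ j + 2) hj) (H' * At - At * H') -
          (B m : ℂ) • spinEmbed (spinToTorusEmb (2 * κ j + 2) hj)
            (∑ y : ↥Λ', (latticeStagger (y : Site d) : ℂ) • (siteSpin n y α * At - At * siteSpin n y α)) :=
      sourcedAF_commutator_spinEmbed_xxz hk J Δ α (B m) hj A
    have hXC : Xᴴ * (sourcedAF d (2 * κ j + 2) n J Δ α (B m) * X - X * sourcedAF d (2 * κ j + 2) n J Δ α (B m)) =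
        spinEmbed (spinToTorusEmb (2 * κ j + 2) hj) C -
          (B m : ℂ) • spinEmbed (spinToTorusEmb (2 * κ j + 2) hj) D := by
      rw [hcomm, Matrix.mul_sub, Matrix.mul_smul, hX, ← spinEmbed_conjTranspose, ← map_mul, ← map_mul]
    have hval : (sourcedAF d (2 * κ j + 2) n J Δ α (B m)).groundStateFunctional
          (spinEmbed (spinToTorusEmb (2 * κ j + 2) hj) C) -
        (B m : ℂ) * (sourcedAF d (2 * κ j + 2) n J Δ α (B m)).groundStateFunctional
          (spinEmbed (spinToTorusEmb (2 * κ j + 2) hj) D) =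
        (sourcedAF d (2 * κ j + 2) n J Δ α (B m)).groundStateFunctional
          (Xᴴ * (sourcedAF d (2 * κ j + 2) n J Δ α (B m) * X - X * sourcedAF d (2 * κ j + 2) n J Δ α (B m))) := by
      rw [hXC, map_sub, map_smul, smul_eq_mul]
    rw [hval]
    exact groundStateFunctional_conjTranspose_comm_mul_nonneg (sourcedAF_isHermitian n J Δ α (B m)) X
  -- Step B: `B_m ω_m(D) → 0` and `ω_m(C) → ω(C)`
  have hbd : ∀ m, ‖(ωB m).expect Λ' D‖ ≤ ‖D‖ := fun m => (ωB m).norm_expect_le_holds Λ' D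
  have hBD : Tendsto (fun m => (B m : ℂ) * (ωB m).expect Λ' D) atTop (𝓝 0) := by
    have hB0' : Tendsto (fun m => (B m : ℂ)) atTop (𝓝 0) := by
      have := Complex.continuous_ofReal.tendsto 0
      rw [Complex.ofReal_zero] at this
      exact this.comp hB0
    refine squeeze_zero_norm (a := fun m => ‖(B m : ℂ)‖ * ‖D‖) (fun m => ?_) ?_
    · rw [norm_mul]; exact mul_le_mul_of_nonneg_left (hbd m) (norm_nonneg _)
    · simpa using hB0'.norm.mul_const ‖D‖
  have hT : Tendsto (fun m => (ωB m).expect Λ' C - (B m : ℂ) * (ωB m).expect Λ' D) atTop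
      (𝓝 (ω.expect Λ' C - 0)) := (hlim Λ' C).sub hBD
  rw [sub_zero] at hT
  exact ge_of_tendsto' hT hstep

end Ground

/-! ### `T > 0`: the EEB, stationarity and reality rows; the thermal states are dKMS states -/

section Thermal

variable {n : ℕ} {J Δ : ℝ} {α : Fin 3} {β : ℝ} {ω : InfVolState d (n + 1)}

/-- **THE TANGENT EEB ROWS for the XXZ dynamics** (every `Δ`): for every infinitesimal-field thermal state `ω̃` at
`β`, finite `Λ`, `A ∈ 𝔄_Λ` and real `θ`,
`θ·Re ω̃(ÃᴴÃ) − e^{θ−1}·Re ω̃(ÃÃᴴ) ≤ β·Re ω̃(Ãᴴ(H_{Λ_1}Ã − ÃH_{Λ_1}))`, `H_{Λ_1}` the local XXZ Hamiltonian.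
[cite: FawziFawziScalet2024, Thm. 3.1 (5)] [cite: BratteliRobinsonII1997, Thm. 5.3.15] -/
theorem IsInfinitesimalFieldThermalState.eeb_tangent_le_xxz (h : IsInfinitesimalFieldThermalState d n J Δ α β ω)
    (Λ : Finset (Site d)) (A : Op ↥Λ (n + 1)) (θ : ℝ) :
    θ * (ω.expect (thicken Λ 1) ((embedOp (subset_thicken Λ 1) A)ᴴ * embedOp (subset_thicken Λ 1) A)).re -
        Real.exp (θ - 1) *
          (ω.expect (thicken Λ 1) (embedOp (subset_thicken Λ 1) A * (embedOp (subset_thicken Λ 1) A)ᴴ)).re ≤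
      β * (ω.expect (thicken Λ 1) ((embedOp (subset_thicken Λ 1) A)ᴴ *
        (localHamiltonian ((xxzLatticeInteraction d n J Δ).restrict (thicken Λ 1)) univ *
            embedOp (subset_thicken Λ 1) A -
          embedOp (subset_thicken Λ 1) A *
            localHamiltonian ((xxzLatticeInteraction d n J Δ).restrict (thicken Λ 1)) univ))).re := by
  set Λ' := thicken Λ (1 : ℝ) with hΛ'
  set At : Op ↥Λ' (n + 1) := embedOp (subset_thicken Λ 1) A with hAt
  set H' : Op ↥Λ' (n + 1) := localHamiltonian ((xxzLatticeInteraction d n J Δ).restrict Λ') univ with hH'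
  set C : Op ↥Λ' (n + 1) := Atᴴ * (H' * At - At * H') with hC
  set D : Op ↥Λ' (n + 1) :=
    Atᴴ * ∑ y : ↥Λ', (latticeStagger (y : Site d) : ℂ) • (siteSpin n y α * At - At * siteSpin n y α) with hD
  set P : Op ↥Λ' (n + 1) := ((θ : ℝ) : ℂ) • (Atᴴ * At) - ((Real.exp (θ - 1) : ℝ) : ℂ) • (At * Atᴴ) with hP
  set Q : Op ↥Λ' (n + 1) := ((β : ℝ) : ℂ) • C with hQ
  have hmain := h.re_expect_le_of_torus_rows P Q (((β : ℝ) : ℂ) • D) fun B k h' => by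
    have hk : Even (2 * k + 2) := ⟨k + 1, by ring⟩
    set X := spinEmbed (spinToTorusEmb (2 * k + 2) h') At with hX
    have hKh : (sourcedAF d (2 * k + 2) n J Δ α B).IsHermitian := sourcedAF_isHermitian n J Δ α B
    have hrow := hKh.eeb_tangent_le β θ X
    have hXX : Xᴴ * X = spinEmbed (spinToTorusEmb (2 * k + 2) h') (Atᴴ * At) := by
      rw [hX, map_mul, spinEmbed_conjTranspose]
    have hXX' : X * Xᴴ = spinEmbed (spinToTorusEmb (2 * k + 2) h') (At * Atᴴ) := by
      rw [hX, map_mul, spinEmbed_conjTranspose]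
    have hcomm : sourcedAF d (2 * k + 2) n J Δ α B * X - X * sourcedAF d (2 * k + 2) n J Δ α B =
        spinEmbed (spinToTorusEmb (2 * k + 2) h') (H' * At - At * H') -
          (B : ℂ) • spinEmbed (spinToTorusEmb (2 * k + 2) h')
            (∑ y : ↥Λ', (latticeStagger (y : Site d) : ℂ) • (siteSpin n y α * At - At * siteSpin n y α)) :=
      sourcedAF_commutator_spinEmbed_xxz hk J Δ α B h' A
    have hXC : Xᴴ * (sourcedAF d (2 * k + 2) n J Δ α B * X - X * sourcedAF d (2 * k + 2) n J Δ α B) =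
        spinEmbed (spinToTorusEmb (2 * k + 2) h') C - (B : ℂ) • spinEmbed (spinToTorusEmb (2 * k + 2) h') D := by
      rw [hcomm, Matrix.mul_sub, Matrix.mul_smul, hX, ← spinEmbed_conjTranspose, ← map_mul, ← map_mul]
    rw [hXX, hXX', hXC] at hrow
    simp only [map_sub, map_smul, smul_eq_mul, Complex.sub_re, Complex.re_ofReal_mul] at hrow
    simp only [hP, hQ, map_sub, map_smul, smul_eq_mul, Complex.sub_re, Complex.re_ofReal_mul]
    linarith
  simp only [hP, hQ, map_sub, map_smul, smul_eq_mul, Complex.sub_re, Complex.re_ofReal_mul] at hmain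
  exact hmain

/-- **THE STATIONARITY ROWS for the XXZ dynamics**: `ω̃(H_{Λ_1}Ã − ÃH_{Λ_1}) = 0` for every local `A`.
[cite: FawziFawziScalet2024, Thm. 3.1 (4)] [cite: BratteliRobinsonII1997, Thm. 5.3.15] -/
theorem IsInfinitesimalFieldThermalState.expect_commutator_eq_zero_xxz
    (h : IsInfinitesimalFieldThermalState d n J Δ α β ω) (Λ : Finset (Site d)) (A : Op ↥Λ (n + 1)) :
    ω.expect (thicken Λ 1)
        (localHamiltonian ((xxzLatticeInteraction d n J Δ).restrict (thicken Λ 1)) univ *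
            embedOp (subset_thicken Λ 1) A -
          embedOp (subset_thicken Λ 1) A *
            localHamiltonian ((xxzLatticeInteraction d n J Δ).restrict (thicken Λ 1)) univ) = 0 := by
  set Λ' := thicken Λ (1 : ℝ) with hΛ'
  set At : Op ↥Λ' (n + 1) := embedOp (subset_thicken Λ 1) A with hAt
  set H' : Op ↥Λ' (n + 1) := localHamiltonian ((xxzLatticeInteraction d n J Δ).restrict Λ') univ with hH'
  set C₀ : Op ↥Λ' (n + 1) := H' * At - At * H' with hC₀
  set D₀ : Op ↥Λ' (n + 1) :=
    ∑ y : ↥Λ', (latticeStagger (y : Site d) : ℂ) • (siteSpin n y α * At - At * siteSpin n y α) with hD₀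
  have hfin : ∀ (B : ℝ) (k : ℕ) (h' : Set.InjOn (Torus.proj (d := d) (2 * k + 2)) ↑Λ'),
      gibbsState β (sourcedAF d (2 * k + 2) n J Δ α B) (spinEmbed (spinToTorusEmb (2 * k + 2) h') C₀) -
        (B : ℂ) * gibbsState β (sourcedAF d (2 * k + 2) n J Δ α B) (spinEmbed (spinToTorusEmb (2 * k + 2) h') D₀) =
          0 := by
    intro B k h'
    have hk : Even (2 * k + 2) := ⟨k + 1, by ring⟩
    have hcomm : sourcedAF d (2 * k + 2) n J Δ α B * spinEmbed (spinToTorusEmb (2 * k + 2) h') At -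
        spinEmbed (spinToTorusEmb (2 * k + 2) h') At * sourcedAF d (2 * k + 2) n J Δ α B =
        spinEmbed (spinToTorusEmb (2 * k + 2) h') C₀ - (B : ℂ) • spinEmbed (spinToTorusEmb (2 * k + 2) h') D₀ :=
      sourcedAF_commutator_spinEmbed_xxz hk J Δ α B h' A
    have h0 := Matrix.gibbsState_commutator_eq_zero β (sourcedAF d (2 * k + 2) n J Δ α B)
      (spinEmbed (spinToTorusEmb (2 * k + 2) h') At)
    rw [hcomm, map_sub, map_smul, smul_eq_mul] at h0
    exact h0
  have hre : ∀ s : ℂ, (ω.expect Λ' (s • C₀)).re ≤ (ω.expect Λ' 0).re := by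
    intro s
    refine h.re_expect_le_of_torus_rows (s • C₀) 0 (-(s • D₀)) fun B k h' => ?_
    have h1 : s * gibbsState β (sourcedAF d (2 * k + 2) n J Δ α B) (spinEmbed (spinToTorusEmb (2 * k + 2) h') C₀) =
        (B : ℂ) * (s * gibbsState β (sourcedAF d (2 * k + 2) n J Δ α B)
          (spinEmbed (spinToTorusEmb (2 * k + 2) h') D₀)) := by
      rw [eq_of_sub_eq_zero (hfin B k h')]; ring
    simp only [map_smul, map_zero, map_neg, smul_eq_mul, Complex.zero_re, Complex.neg_re]
    rw [h1, Complex.re_ofReal_mul]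
    linarith
  have h1 := hre 1
  have h2 := hre (-1)
  have h3 := hre Complex.I
  have h4 := hre (-Complex.I)
  simp only [map_smul, map_zero, Complex.zero_re, smul_eq_mul, one_mul, neg_mul, Complex.neg_re,
    Complex.I_mul_re, neg_neg] at h1 h2 h3 h4
  apply Complex.ext
  · rw [Complex.zero_re]; linarith
  · rw [Complex.zero_im]; linarith

/-- **`(C-1)` for the XXZ dynamics**: `ω̃(Ãᴴ[H_{Λ_1}, Ã])` is real. [cite: ArakiMoriya2003, Def 6.3 (C-1)]
[cite: BratteliRobinsonII1997, Thm. 5.3.15] -/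
theorem IsInfinitesimalFieldThermalState.im_expect_conjTranspose_mul_commutator_eq_zero_xxz
    (h : IsInfinitesimalFieldThermalState d n J Δ α β ω) (Λ : Finset (Site d)) (A : Op ↥Λ (n + 1)) :
    (ω.expect (thicken Λ 1) ((embedOp (subset_thicken Λ 1) A)ᴴ *
        (localHamiltonian ((xxzLatticeInteraction d n J Δ).restrict (thicken Λ 1)) univ *
            embedOp (subset_thicken Λ 1) A -
          embedOp (subset_thicken Λ 1) A *
            localHamiltonian ((xxzLatticeInteraction d n J Δ).restrict (thicken Λ 1)) univ))).im = 0 := by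
  set Λ' := thicken Λ (1 : ℝ) with hΛ'
  set At : Op ↥Λ' (n + 1) := embedOp (subset_thicken Λ 1) A with hAt
  set H' : Op ↥Λ' (n + 1) := localHamiltonian ((xxzLatticeInteraction d n J Δ).restrict Λ') univ with hH'
  set C : Op ↥Λ' (n + 1) := Atᴴ * (H' * At - At * H') with hC
  set D : Op ↥Λ' (n + 1) :=
    Atᴴ * ∑ y : ↥Λ', (latticeStagger (y : Site d) : ℂ) • (siteSpin n y α * At - At * siteSpin n y α) with hD
  have hfin : ∀ (B : ℝ) (k : ℕ) (h' : Set.InjOn (Torus.proj (d := d) (2 * k + 2)) ↑Λ'),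
      (gibbsState β (sourcedAF d (2 * k + 2) n J Δ α B) (spinEmbed (spinToTorusEmb (2 * k + 2) h') C)).im -
        B * (gibbsState β (sourcedAF d (2 * k + 2) n J Δ α B) (spinEmbed (spinToTorusEmb (2 * k + 2) h') D)).im =
          0 := by
    intro B k h'
    have hk : Even (2 * k + 2) := ⟨k + 1, by ring⟩
    set X := spinEmbed (spinToTorusEmb (2 * k + 2) h') At with hX
    have hcomm : sourcedAF d (2 * k + 2) n J Δ α B * X - X * sourcedAF d (2 * k + 2) n J Δ α B =
        spinEmbed (spinToTorusEmb (2 * k + 2) h') (H' * At - At * H') -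
          (B : ℂ) • spinEmbed (spinToTorusEmb (2 * k + 2) h')
            (∑ y : ↥Λ', (latticeStagger (y : Site d) : ℂ) • (siteSpin n y α * At - At * siteSpin n y α)) :=
      sourcedAF_commutator_spinEmbed_xxz hk J Δ α B h' A
    have hXC : Xᴴ * (sourcedAF d (2 * k + 2) n J Δ α B * X - X * sourcedAF d (2 * k + 2) n J Δ α B) =
        spinEmbed (spinToTorusEmb (2 * k + 2) h') C - (B : ℂ) • spinEmbed (spinToTorusEmb (2 * k + 2) h') D := by
      rw [hcomm, Matrix.mul_sub, Matrix.mul_smul, hX, ← spinEmbed_conjTranspose, ← map_mul, ← map_mul]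
    have him := (sourcedAF_isHermitian (L := 2 * k + 2) n J Δ α B).im_gibbsState_conjTranspose_mul_commutator X β
    rw [hXC, map_sub, map_smul, Complex.sub_im, smul_eq_mul, Complex.im_ofReal_mul] at him
    exact him
  have hre : ∀ s : ℂ, s = Complex.I ∨ s = -Complex.I → (ω.expect Λ' (s • C)).re ≤ (ω.expect Λ' 0).re := by
    intro s hs
    refine h.re_expect_le_of_torus_rows (s • C) 0 (-(s • D)) fun B k h' => ?_
    have h0 := hfin B k h'
    simp only [map_smul, map_zero, map_neg, smul_eq_mul, Complex.zero_re, Complex.neg_re]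
    rcases hs with rfl | rfl
    · rw [Complex.I_mul_re, Complex.I_mul_re]; linarith
    · rw [neg_mul, neg_mul, Complex.neg_re, Complex.neg_re, Complex.I_mul_re, Complex.I_mul_re]; linarith
  have h3 := hre Complex.I (Or.inl rfl)
  have h4 := hre (-Complex.I) (Or.inr rfl)
  simp only [map_smul, map_zero, Complex.zero_re, smul_eq_mul, Complex.neg_re, Complex.I_mul_re, neg_mul,
    neg_neg] at h3 h4
  linarith

/-- The supremum of the tangent family: from `θ u − e^{θ−1} v ≤ βc` for all real `θ` (`u, v ≥ 0`) follow the
`+∞`-clause `0 < u → 0 < v` and `(C-2)` `u log(u/v) ≤ βc`. [cite: BoydVandenberghe2004, §3.3.1 Example 3.21] -/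
theorem eeb_clauses_of_tangent {u v c β : ℝ} (hu0 : 0 ≤ u) (hv0 : 0 ≤ v)
    (ht : ∀ θ : ℝ, θ * u - Real.exp (θ - 1) * v ≤ β * c) :
    (0 < u → 0 < v) ∧ u * Real.log (u / v) ≤ β * c := by
  have hinf : 0 < u → 0 < v := by
    intro hupos
    by_contra hvn
    have hv00 : v = 0 := le_antisymm (not_lt.1 hvn) hv0
    have h1 := ht ((β * c + 1) / u)
    rw [hv00, mul_zero, sub_zero, div_mul_cancel₀ _ hupos.ne'] at h1
    linarith
  refine ⟨hinf, ?_⟩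
  rcases hu0.eq_or_lt with hu00 | hupos
  · rw [← hu00, zero_mul]
    rcases hv0.eq_or_lt with hv00 | hvpos
    · have h1 := ht 0
      rw [← hu00, ← hv00, mul_zero, mul_zero, sub_zero] at h1
      exact h1
    · refine le_of_not_gt fun hneg => ?_
      have hpos : 0 < -(β * c) / (2 * v) := div_pos (by linarith) (by linarith)
      have h1 := ht (1 + Real.log (-(β * c) / (2 * v)))
      rw [← hu00, mul_zero, zero_sub, add_sub_cancel_left, Real.exp_log hpos] at h1
      have h2 : -(β * c) / (2 * v) * v = -(β * c) / 2 := by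
        field_simp
      rw [h2] at h1
      linarith
  · have hvpos := hinf hupos
    have h2 := ht (1 + Real.log (u / v))
    rwa [tangent_eq_mul_log_div hupos hvpos] at h2

/-- **`(C-2)` with its `+∞`-clause for the XXZ dynamics**: `0 < u → 0 < v` and `u log(u/v) ≤ βc` with
`u = Re ω̃(ÃᴴÃ)`, `v = Re ω̃(ÃÃᴴ)`, `c = Re ω̃(Ãᴴ[H_{Λ_1}, Ã])`. [cite: ArakiMoriya2003, Def 6.3 (C-2)]
[cite: BratteliRobinsonII1997, Thm. 5.3.15] [cite: FawziFawziScalet2024, Thm. 3.1 (5)] -/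
theorem IsInfinitesimalFieldThermalState.eeb_le_xxz (h : IsInfinitesimalFieldThermalState d n J Δ α β ω)
    (Λ : Finset (Site d)) (A : Op ↥Λ (n + 1)) :
    (0 < (ω.expect (thicken Λ 1) ((embedOp (subset_thicken Λ 1) A)ᴴ * embedOp (subset_thicken Λ 1) A)).re →
        0 < (ω.expect (thicken Λ 1) (embedOp (subset_thicken Λ 1) A * (embedOp (subset_thicken Λ 1) A)ᴴ)).re) ∧
      (ω.expect (thicken Λ 1) ((embedOp (subset_thicken Λ 1) A)ᴴ * embedOp (subset_thicken Λ 1) A)).re *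
          Real.log ((ω.expect (thicken Λ 1) ((embedOp (subset_thicken Λ 1) A)ᴴ * embedOp (subset_thicken Λ 1) A)).re /
            (ω.expect (thicken Λ 1) (embedOp (subset_thicken Λ 1) A * (embedOp (subset_thicken Λ 1) A)ᴴ)).re) ≤
        β * (ω.expect (thicken Λ 1) ((embedOp (subset_thicken Λ 1) A)ᴴ *
          (localHamiltonian ((xxzLatticeInteraction d n J Δ).restrict (thicken Λ 1)) univ *
              embedOp (subset_thicken Λ 1) A -
            embedOp (subset_thicken Λ 1) A *
              localHamiltonian ((xxzLatticeInteraction d n J Δ).restrict (thicken Λ 1)) univ))).re := by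
  refine eeb_clauses_of_tangent ?_ ?_ (h.eeb_tangent_le_xxz Λ A)
  · exact (Complex.nonneg_iff.1 ((ω.expect_nonneg (thicken Λ 1) (embedOp (subset_thicken Λ 1) A)))).1
  · have := ω.expect_nonneg (thicken Λ 1) (embedOp (subset_thicken Λ 1) A)ᴴ
    rw [conjTranspose_conjTranspose] at this
    exact (Complex.nonneg_iff.1 this).1

/-- **THE INFINITESIMAL-FIELD THERMAL STATES OF THE XXZ ANTIFERROMAGNET ARE dKMS (ENERGY–ENTROPY-BALANCE) STATES**
of the nearest-neighbour XXZ interaction at inverse temperature `β` (range `1`), for every `Δ`, `J`, `d`, `n`, `α`.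
[cite: ArakiMoriya2003, Def 6.3] [cite: BratteliRobinsonII1997, Thm. 5.3.15] [cite: KomaTasaki1993, §1 (1.8)] -/
theorem IsInfinitesimalFieldThermalState.isDKMSState_xxz (h : IsInfinitesimalFieldThermalState d n J Δ α β ω) :
    ω.IsDKMSState (xxzLatticeInteraction d n J Δ) 1 β := by
  intro Λ A
  set Λ' := thicken Λ (1 : ℝ) with hΛ'
  set At : Op ↥Λ' (n + 1) := embedOp (subset_thicken Λ 1) A with hAt
  set H' : Op ↥Λ' (n + 1) := localHamiltonian ((xxzLatticeInteraction d n J Δ).restrict Λ') univ with hH'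
  set C : Op ↥Λ' (n + 1) := Atᴴ * (H' * At - At * H') with hC
  have hder : ω.expect Λ' (Atᴴ * derivation (xxzLatticeInteraction d n J Δ) 1 Λ A) =
      Complex.I * ω.expect Λ' C := by
    have : derivation (xxzLatticeInteraction d n J Δ) 1 Λ A = Complex.I • (H' * At - At * H') := rfl
    rw [this, Matrix.mul_smul, map_smul, smul_eq_mul]
  have hu : ω.expect Λ' (Atᴴ * At) = ω.expect Λ (Aᴴ * A) := by
    rw [hAt, ← embedOp_conjTranspose, ← embedOp_mul, ω.compatible]
  have hv : ω.expect Λ' (At * Atᴴ) = ω.expect Λ (A * Aᴴ) := by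
    rw [hAt, ← embedOp_conjTranspose, ← embedOp_mul, ω.compatible]
  have him : (ω.expect Λ' C).im = 0 := h.im_expect_conjTranspose_mul_commutator_eq_zero_xxz Λ A
  have heeb : (0 < (ω.expect Λ' (Atᴴ * At)).re → 0 < (ω.expect Λ' (At * Atᴴ)).re) ∧
      (ω.expect Λ' (Atᴴ * At)).re * Real.log ((ω.expect Λ' (Atᴴ * At)).re / (ω.expect Λ' (At * Atᴴ)).re) ≤
        β * (ω.expect Λ' C).re := h.eeb_le_xxz Λ A
  rw [hu, hv] at heeb
  refine ⟨?_, heeb.1, ?_⟩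
  · rw [hder, Complex.I_mul_re, neg_eq_zero]
    exact him
  · rw [hder, ← mul_assoc, neg_mul, Complex.I_mul_I, neg_neg, one_mul]
    exact heeb.2

end Thermal

/-! ### Long-range order: Néel order for `Δ ≥ 1`, planar order for `0 ≤ Δ ≤ 1`; non-uniqueness -/

section Order

variable {n : ℕ} {J Δ : ℝ}

/-- The stationarity row in `derivation` form: `ω̃(δA) = 0`. [cite: FawziFawziScalet2024, Thm. 3.1 (4)] -/
theorem IsInfinitesimalFieldThermalState.expect_derivation_eq_zero_xxz {α : Fin 3} {β : ℝ} {ω : InfVolState d (n + 1)}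
    (h : IsInfinitesimalFieldThermalState d n J Δ α β ω) (Λ : Finset (Site d)) (A : Op ↥Λ (n + 1)) :
    ω.expect (thicken Λ 1) (derivation (xxzLatticeInteraction d n J Δ) 1 Λ A) = 0 := by
  have hder : derivation (xxzLatticeInteraction d n J Δ) 1 Λ A = Complex.I •
      (localHamiltonian ((xxzLatticeInteraction d n J Δ).restrict (thicken Λ 1)) univ *
          embedOp (subset_thicken Λ 1) A -
        embedOp (subset_thicken Λ 1) A *
          localHamiltonian ((xxzLatticeInteraction d n J Δ).restrict (thicken Λ 1)) univ) := rfl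
  rw [hder, map_smul, h.expect_commutator_eq_zero_xxz Λ A, smul_zero]

/-- **ISING REGIME `Δ ≥ 1`, `T > 0`, `d ≥ 3`: A dKMS STATE OF THE XXZ ANTIFERROMAGNET WITH NÉEL ORDER** (`J > 0`,
`S = n/2 ≥ ½`): there is `β₀ > 0` such that for every `β ≥ β₀` there are `σ > 0` and a dKMS state `ω` at `β` of
`xxzLatticeInteraction d n J Δ` — stationary, invariant under the even translations, with the same staggered
`z`-magnetisation at every site and `(-1)^x Re ω(Sᶻ_x) ≥ σ` at every site (Dyson–Lieb–Simon / Koma–Tasaki Thm. 7.1 in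
infinite volume via the infinitesimal field (1.8)). [cite: KomaTasaki1993, §7 Thm. 7.1, §1 (1.8)–(1.10)]
[cite: DLS1978, Thm. 5.1] [cite: ArakiMoriya2003, Def 6.3] -/
theorem xxzAF_exists_dKMSState_neelOrder (hd : 3 ≤ d) (hn : 1 ≤ n) (hJ : 0 < J) (hΔ : 1 ≤ Δ) :
    ∃ β₀ : ℝ, 0 < β₀ ∧ ∀ β : ℝ, β₀ ≤ β → ∃ σ : ℝ, 0 < σ ∧ ∃ ω : InfVolState d (n + 1),
      ω.IsDKMSState (xxzLatticeInteraction d n J Δ) 1 β ∧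
      (∀ (Λ : Finset (Site d)) (A : Op ↥Λ (n + 1)),
        ω.expect (thicken Λ 1) (derivation (xxzLatticeInteraction d n J Δ) 1 Λ A) = 0) ∧
      (∀ v : Site d, latticeStagger v = 1 → ω.shift v = ω) ∧
      (∀ x y : Site d, latticeStagger x * (ω.expect {x} (siteSpinAt n x 2)).re =
        latticeStagger y * (ω.expect {y} (siteSpinAt n y 2)).re) ∧
      ∀ x : Site d, σ ≤ latticeStagger x * (ω.expect {x} (siteSpinAt n x 2)).re := by
  obtain ⟨β₀, hβ₀, H⟩ := xxzAF_infiniteVolume_spontaneousNeelMagnetisation hd hn hJ hΔ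
  refine ⟨β₀, hβ₀, fun β hβ => ?_⟩
  obtain ⟨σ, hσ, -, hfloor⟩ := H β hβ
  obtain ⟨ω, hω⟩ := exists_isInfinitesimalFieldThermalState (d := d) (n := n) J Δ 2 β
  obtain ⟨hshift, hconst⟩ := hω.shift_eq_and_stagMagnetisation_eq
  exact ⟨σ, hσ, ω, hω.isDKMSState_xxz, hω.expect_derivation_eq_zero_xxz, hshift, hconst, hfloor ω hω⟩

/-- **PLANAR REGIME `0 ≤ Δ ≤ 1`, `T > 0`, `d ≥ 3`: A dKMS STATE OF THE XXZ ANTIFERROMAGNET WITH PLANAR STAGGERED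
ORDER** `(-1)^x Re ω(Sˣ_x) ≥ √2σ` at every site (Koma–Tasaki Thm. 7.3 / (1.10) with the `U(1)` factor `√2`, in infinite
volume). [cite: KomaTasaki1993, §7 Thm. 7.3, §1 (1.8)–(1.10)] [cite: DLS1978, Thm. 5.1] [cite: ArakiMoriya2003, Def 6.3] -/
theorem xxzAF_exists_dKMSState_planarOrder (hd : 3 ≤ d) (hn : 1 ≤ n) (hJ : 0 < J) (hΔ : 0 ≤ Δ) (hΔ' : Δ ≤ 1) :
    ∃ β₀ : ℝ, 0 < β₀ ∧ ∀ β : ℝ, β₀ ≤ β → ∃ σ : ℝ, 0 < σ ∧ ∃ ω : InfVolState d (n + 1),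
      ω.IsDKMSState (xxzLatticeInteraction d n J Δ) 1 β ∧
      (∀ (Λ : Finset (Site d)) (A : Op ↥Λ (n + 1)),
        ω.expect (thicken Λ 1) (derivation (xxzLatticeInteraction d n J Δ) 1 Λ A) = 0) ∧
      (∀ v : Site d, latticeStagger v = 1 → ω.shift v = ω) ∧
      (∀ x y : Site d, latticeStagger x * (ω.expect {x} (siteSpinAt n x 0)).re =
        latticeStagger y * (ω.expect {y} (siteSpinAt n y 0)).re) ∧
      ∀ x : Site d, Real.sqrt 2 * σ ≤ latticeStagger x * (ω.expect {x} (siteSpinAt n x 0)).re := by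
  obtain ⟨β₀, hβ₀, H⟩ := xxzAF_infiniteVolume_spontaneousStaggeredMagnetisation hd hn hJ hΔ hΔ'
  refine ⟨β₀, hβ₀, fun β hβ => ?_⟩
  obtain ⟨σ, hσ, -, hfloor⟩ := H β hβ
  obtain ⟨ω, hω⟩ := exists_isInfinitesimalFieldThermalState (d := d) (n := n) J Δ 0 β
  obtain ⟨hshift, hconst⟩ := hω.shift_eq_and_stagMagnetisation_eq
  exact ⟨σ, hσ, ω, hω.isDKMSState_xxz, hω.expect_derivation_eq_zero_xxz, hshift, hconst, hfloor ω hω⟩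

/-- **NON-UNIQUENESS OF THE dKMS STATE OF THE XXZ ANTIFERROMAGNET AT LOW TEMPERATURE** (`d ≥ 3`, `J > 0`,
`S = n/2 ≥ ½`, every `Δ ≥ 0`): there is `β₀ > 0` such that for every `β ≥ β₀` there are two distinct dKMS states at
`β`, and the Néel / planar-ordered one breaks the unit translations (`ω ∘ τ_{e_i} ≠ ω`, each translate again dKMS).
For `Δ ≥ 1` the `z`-sourced state has `(-1)^x Re ω(Sᶻ_x) ≥ σ > 0` while the `y`-sourced one has `ω(Sᶻ_x) = 0`; for
`Δ ≤ 1` the same with `Sˣ`. [cite: DLS1978, Thm. 5.1] [cite: KomaTasaki1993, §7 Thms. 7.1, 7.3, §1 (1.8)]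
[cite: ArakiMoriya2003, Def 6.3] [cite: BratteliRobinsonII1997, Thm. 5.3.15, Thm. 6.2.4] -/
theorem xxzAF_dKMSState_not_unique (hd : 3 ≤ d) (hn : 1 ≤ n) (hJ : 0 < J) (hΔ : 0 ≤ Δ) :
    ∃ β₀ : ℝ, 0 < β₀ ∧ ∀ β : ℝ, β₀ ≤ β → ∃ ω₀ ω₁ : InfVolState d (n + 1),
      ω₀.IsDKMSState (xxzLatticeInteraction d n J Δ) 1 β ∧
      ω₁.IsDKMSState (xxzLatticeInteraction d n J Δ) 1 β ∧ ω₀ ≠ ω₁ ∧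
      ∀ i : Fin d, (ω₀.shift (unitVec i)).IsDKMSState (xxzLatticeInteraction d n J Δ) 1 β ∧
        ω₀.shift (unitVec i) ≠ ω₀ := by
  have hΦ := isTranslationInvariant_xxzLatticeInteraction (d := d) n J Δ
  rcases le_total 1 Δ with hΔ1 | hΔ1
  · -- Ising regime: order along `z`
    obtain ⟨β₀, hβ₀, H⟩ := xxzAF_infiniteVolume_spontaneousNeelMagnetisation hd hn hJ hΔ1
    refine ⟨β₀, hβ₀, fun β hβ => ?_⟩
    obtain ⟨σ, hσ, -, hfloor⟩ := H β hβ
    obtain ⟨ω₀, hω₀⟩ := exists_isInfinitesimalFieldThermalState (d := d) (n := n) J Δ 2 β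
    obtain ⟨ω₁, hω₁⟩ := exists_isInfinitesimalFieldThermalState (d := d) (n := n) J Δ 1 β
    refine ⟨ω₀, ω₁, hω₀.isDKMSState_xxz, hω₁.isDKMSState_xxz, fun heq => ?_, fun i =>
      ⟨hω₀.isDKMSState_xxz.shift hΦ _, fun heq => ?_⟩⟩
    · have h0 := hfloor ω₀ hω₀ 0
      rw [heq, hω₁.expect_siteSpinAt_two_eq_zero 0, Complex.zero_re, mul_zero] at h0
      linarith
    · have h1 := hfloor ω₀ hω₀ 0
      have h2 := hfloor ω₀ hω₀ ((0 : Site d) + unitVec i)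
      rw [latticeStagger_add_unitVec, ← InfVolState.shift_expect_siteSpinAt ω₀ (unitVec i) 0 2, heq, neg_mul] at h2
      linarith
  · -- planar regime: order along `x`
    obtain ⟨β₀, hβ₀, H⟩ := xxzAF_infiniteVolume_spontaneousStaggeredMagnetisation hd hn hJ hΔ hΔ1
    refine ⟨β₀, hβ₀, fun β hβ => ?_⟩
    obtain ⟨σ, hσ, -, hfloor⟩ := H β hβ
    obtain ⟨ω₀, hω₀⟩ := exists_isInfinitesimalFieldThermalState (d := d) (n := n) J Δ 0 β
    obtain ⟨ω₁, hω₁⟩ := exists_isInfinitesimalFieldThermalState (d := d) (n := n) J Δ 1 β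
    have h2 : (0 : ℝ) < Real.sqrt 2 * σ := mul_pos (Real.sqrt_pos.2 (by norm_num)) hσ
    refine ⟨ω₀, ω₁, hω₀.isDKMSState_xxz, hω₁.isDKMSState_xxz, fun heq => ?_, fun i =>
      ⟨hω₀.isDKMSState_xxz.shift hΦ _, fun heq => ?_⟩⟩
    · have h0 := hfloor ω₀ hω₀ 0
      rw [heq, hω₁.expect_siteSpinAt_zero_eq_zero 0, Complex.zero_re, mul_zero] at h0
      linarith
    · have h1 := hfloor ω₀ hω₀ 0
      have h3 := hfloor ω₀ hω₀ ((0 : Site d) + unitVec i)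
      rw [latticeStagger_add_unitVec, ← InfVolState.shift_expect_siteSpinAt ω₀ (unitVec i) 0 0, heq, neg_mul] at h3
      linarith

/-- **ISING REGIME `Δ ≥ 1`, `T = 0`: AN INFINITE-VOLUME GROUND STATE OF THE XXZ ANTIFERROMAGNET WITH NÉEL ORDER**
(`J > 0`, `d ≥ 2`, `S = n/2 ≥ ½`, `(d, S) ≠ (2, ½)`): `ω ∈ groundStates (xxzLatticeInteraction d n J Δ) 1`, invariant
under the even translations, `(-1)^x Re ω(Sᶻ_x) ≥ σ > 0` at every site (Kennedy–Lieb–Shastry / Koma–Tasaki §7 in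
infinite volume). [cite: KomaTasaki1993, §7 Thm. 7.1, §1 (1.8)] [cite: KennedyLiebShastryJSP1988, Theorem]
[cite: BratteliRobinsonII1997, Def. 5.3.18] -/
theorem xxzAF_exists_groundState_neelOrder (hd : 2 ≤ d) (hn : 1 ≤ n) (hdn : ¬ (d = 2 ∧ n = 1)) (hJ : 0 < J)
    (hΔ : 1 ≤ Δ) :
    ∃ σ : ℝ, 0 < σ ∧ ∃ ω : InfVolState d (n + 1),
      ω ∈ groundStates (xxzLatticeInteraction d n J Δ) 1 ∧
      (∀ v : Site d, latticeStagger v = 1 → ω.shift v = ω) ∧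
      (∀ x y : Site d, latticeStagger x * (ω.expect {x} (siteSpinAt n x 2)).re =
        latticeStagger y * (ω.expect {y} (siteSpinAt n y 2)).re) ∧
      ∀ x : Site d, σ ≤ latticeStagger x * (ω.expect {x} (siteSpinAt n x 2)).re := by
  obtain ⟨σ, hσ, -, hfloor⟩ := xxzAF_infiniteVolume_groundState_spontaneousNeelMagnetisation hd hn hdn hJ hΔ
  obtain ⟨ω, hω⟩ := exists_isInfinitesimalFieldGroundState (d := d) (n := n) J Δ 2
  obtain ⟨hshift, hconst⟩ := hω.shift_eq_and_stagMagnetisation_eq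
  exact ⟨σ, hσ, ω, hω.isGroundState_xxz, hshift, hconst, hfloor ω hω⟩

/-- **PLANAR REGIME `0 ≤ Δ ≤ 1`, `T = 0`: AN INFINITE-VOLUME GROUND STATE OF THE XXZ ANTIFERROMAGNET WITH PLANAR
STAGGERED ORDER** `(-1)^x Re ω(Sˣ_x) ≥ √2σ` (`J > 0`, `d ≥ 2`, `(d, S) ≠ (2, ½)`).
[cite: KomaTasaki1993, §7 Thm. 7.3, §1 (1.8)] [cite: KennedyLiebShastryJSP1988, Theorem] [cite: BratteliRobinsonII1997, Def. 5.3.18] -/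
theorem xxzAF_exists_groundState_planarOrder (hd : 2 ≤ d) (hn : 1 ≤ n) (hdn : ¬ (d = 2 ∧ n = 1)) (hJ : 0 < J)
    (hΔ : 0 ≤ Δ) (hΔ' : Δ ≤ 1) :
    ∃ σ : ℝ, 0 < σ ∧ ∃ ω : InfVolState d (n + 1),
      ω ∈ groundStates (xxzLatticeInteraction d n J Δ) 1 ∧
      (∀ v : Site d, latticeStagger v = 1 → ω.shift v = ω) ∧
      (∀ x y : Site d, latticeStagger x * (ω.expect {x} (siteSpinAt n x 0)).re =
        latticeStagger y * (ω.expect {y} (siteSpinAt n y 0)).re) ∧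
      ∀ x : Site d, Real.sqrt 2 * σ ≤ latticeStagger x * (ω.expect {x} (siteSpinAt n x 0)).re := by
  obtain ⟨σ, hσ, -, hfloor⟩ :=
    xxzAF_infiniteVolume_groundState_spontaneousStaggeredMagnetisation hd hn hdn hJ hΔ hΔ'
  obtain ⟨ω, hω⟩ := exists_isInfinitesimalFieldGroundState (d := d) (n := n) J Δ 0
  obtain ⟨hshift, hconst⟩ := hω.shift_eq_and_stagMagnetisation_eq
  exact ⟨σ, hσ, ω, hω.isGroundState_xxz, hshift, hconst, hfloor ω hω⟩

/-- **THE XXZ ANTIFERROMAGNET ON `ℤ^d` DOES NOT HAVE A UNIQUE INFINITE-VOLUME GROUND STATE** (`J > 0`, `d ≥ 2`,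
`S = n/2 ≥ ½`, `(d, S) ≠ (2, ½)`, every `Δ ≥ 0`): the ordered infinitesimal-field ground state (sourced along `z` for
`Δ ≥ 1`, along `x` for `Δ ≤ 1`) and the `y`-sourced one (which has `ω(Sˣ_x) = ω(Sᶻ_x) = 0`) are distinct ground states;
moreover the ordered one breaks the unit translations. [cite: KomaTasaki1993, §7 Thms. 7.1, 7.3, §1 (1.8)]
[cite: KennedyLiebShastryJSP1988, Theorem] [cite: Tasaki2020, §4.4] [cite: BratteliRobinsonII1997, §6.2.7] -/
theorem xxzAF_groundState_not_unique (hd : 2 ≤ d) (hn : 1 ≤ n) (hdn : ¬ (d = 2 ∧ n = 1)) (hJ : 0 < J)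
    (hΔ : 0 ≤ Δ) :
    ∃ ω₀ ω₁ : InfVolState d (n + 1),
      ω₀ ∈ groundStates (xxzLatticeInteraction d n J Δ) 1 ∧ ω₁ ∈ groundStates (xxzLatticeInteraction d n J Δ) 1 ∧
      ω₀ ≠ ω₁ ∧ ∀ i : Fin d, ω₀.shift (unitVec i) ∈ groundStates (xxzLatticeInteraction d n J Δ) 1 ∧
        ω₀.shift (unitVec i) ≠ ω₀ := by
  have hΦ := isTranslationInvariant_xxzLatticeInteraction (d := d) n J Δ
  rcases le_total 1 Δ with hΔ1 | hΔ1
  · obtain ⟨σ, hσ, -, hfloor⟩ := xxzAF_infiniteVolume_groundState_spontaneousNeelMagnetisation hd hn hdn hJ hΔ1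
    obtain ⟨ω₀, hω₀⟩ := exists_isInfinitesimalFieldGroundState (d := d) (n := n) J Δ 2
    obtain ⟨ω₁, hω₁⟩ := exists_isInfinitesimalFieldGroundState (d := d) (n := n) J Δ 1
    refine ⟨ω₀, ω₁, hω₀.isGroundState_xxz, hω₁.isGroundState_xxz, fun heq => ?_, fun i =>
      ⟨shift_mem_groundStates hω₀.isGroundState_xxz hΦ _, fun heq => ?_⟩⟩
    · have h0 := hfloor ω₀ hω₀ 0
      rw [heq, hω₁.expect_siteSpinAt_two_eq_zero 0, Complex.zero_re, mul_zero] at h0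
      linarith
    · have h1 := hfloor ω₀ hω₀ 0
      have h2 := hfloor ω₀ hω₀ ((0 : Site d) + unitVec i)
      rw [latticeStagger_add_unitVec, ← InfVolState.shift_expect_siteSpinAt ω₀ (unitVec i) 0 2, heq, neg_mul] at h2
      linarith
  · obtain ⟨σ, hσ, -, hfloor⟩ :=
      xxzAF_infiniteVolume_groundState_spontaneousStaggeredMagnetisation hd hn hdn hJ hΔ hΔ1
    obtain ⟨ω₀, hω₀⟩ := exists_isInfinitesimalFieldGroundState (d := d) (n := n) J Δ 0
    obtain ⟨ω₁, hω₁⟩ := exists_isInfinitesimalFieldGroundState (d := d) (n := n) J Δ 1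
    have h2 : (0 : ℝ) < Real.sqrt 2 * σ := mul_pos (Real.sqrt_pos.2 (by norm_num)) hσ
    refine ⟨ω₀, ω₁, hω₀.isGroundState_xxz, hω₁.isGroundState_xxz, fun heq => ?_, fun i =>
      ⟨shift_mem_groundStates hω₀.isGroundState_xxz hΦ _, fun heq => ?_⟩⟩
    · have h0 := hfloor ω₀ hω₀ 0
      rw [heq, hω₁.expect_siteSpinAt_zero_eq_zero 0, Complex.zero_re, mul_zero] at h0
      linarith
    · have h1 := hfloor ω₀ hω₀ 0
      have h3 := hfloor ω₀ hω₀ ((0 : Site d) + unitVec i)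
      rw [latticeStagger_add_unitVec, ← InfVolState.shift_expect_siteSpinAt ω₀ (unitVec i) 0 0, heq, neg_mul] at h3
      linarith

/-- In particular `¬ HasUniqueGroundState (xxzLatticeInteraction d n J Δ) 1` (`Δ ≥ 0`, hypotheses as above).
[cite: KomaTasaki1993, §7 Thms. 7.1, 7.3] [cite: Tasaki2020, §4.4] -/
theorem xxzAF_not_hasUniqueGroundState (hd : 2 ≤ d) (hn : 1 ≤ n) (hdn : ¬ (d = 2 ∧ n = 1)) (hJ : 0 < J)
    (hΔ : 0 ≤ Δ) : ¬ HasUniqueGroundState (xxzLatticeInteraction d n J Δ) 1 := by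
  rintro ⟨ω, -, huniq⟩
  obtain ⟨ω₀, ω₁, h₀, h₁, hne, -⟩ := xxzAF_groundState_not_unique hd hn hdn hJ hΔ
  exact hne ((huniq ω₀ h₀).trans (huniq ω₁ h₁).symm)

end Order

end XXZKT

end Literature.MathematicalPhysics.QuantumLattice

end
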